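import Literature.NumberTheory.Sieve.FGKMT2018LocalPairSumPeel
import HarnessLib

/-!
# FGKMT 2018 Theorem 6 / Maynard 2016 Prop. 9.1: `∑_s T(r,s) = φ_ω(r)` («`ω(p) − 1` choices of `s`»)

Sources: J. Maynard, *Dense clusters of primes in subsets*, Compositio Math. 152 (2016) =
arXiv:1405.2593 [Maynard2016DenseClusters], §7 p. 13 (the support set `𝒟_k(𝓛)`: «any prime
`p ∤ WB` divides exactly `k − ω(p)` of the `W_j`», i.e. `p` may divide `d_j` only for the `ω(p)`
chosen indices `j_{p,1}, …, j_{p,ω(p)}`) and proof of Proposition 9.1 pp. 19–20 («Given a choice of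
`r ∈ 𝒟_k` and `A ∣ r`, for each prime `p ∣ A` there are `ω(p) − 1` possible choices of which
components of `s` can be a multiple of `p` …» and the main-term identity
`∑_r (y_r² φ(r)/φ_ω(r)²) ∑_{A∣r} ∏_{p∣A} (−(ω(p)−1)/(p−1)) = ∑_r y_r²/φ_ω(r)`);
K. Ford, B. Green, S. Konyagin, J. Maynard, T. Tao, *Long gaps between primes*, JAMS 31 (2018) =
arXiv:1412.5029v4 [FordGreenKonyaginMaynardTao2018], (7.5) p. 21.

PROVED here (no named facts), on top of `FGKMT2018LocalPairSumPeel` ((9.5)):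

* `admIdx L p` — the set of admissible indices `{j_{p,1}, …, j_{p,ω(p)}}` of `𝒟_k(𝓛)` at `p`
  (`j` is the least index with `p ∣ L_j(n)` for some root `n` of `∏ L_i (mod p)`), and
  **`card_admIdx`**: `#admIdx L p = ω_𝓛(p)` for admissible `𝓛` (roots ↔ least indices);
* `mem_dkBox_iff`, `update_mul_mem_dkBox` (putting a prime `p` at an admissible coordinate keeps
  a vector in `𝒟_k(𝓛)`), `phiOmega_eq_mul_div` (`φ_ω(N) = (p − ω(p)) φ_ω(N/p)`);
* **`sum_filter_localPairSum_eq_phiOmega`** / **`sum_localPairSum_eq_phiOmega`** — for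
  `r ∈ 𝒟_k(𝓛)` with `∏rᵢ ≤ ⌊R⌋`: `∑_{s ∈ 𝒟_k(𝓛)} T(r,s) = φ_ω(r)`. (Peel a prime `p ∣ r_j`:
  the `s` with `∏s = ∏r` are `s' · p@j'` with `j'` admissible and `∏s' = ∏r/p`; by (9.5)
  `T(r, s'p@j') = S_p T(r/p, s')` with `∑_{j'} S_p = (p − 1) − (ω(p) − 1) = p − ω(p)`.)
  This is the counting step «`ω(p) − 1` choices» of Maynard's main-term evaluation: with
  `y_s = y_r + (y_s − y_r)` it turns `∑_{r,s} y_r y_s T(r,s)/(φ_ω(r)φ_ω(s))` into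
  `∑_r y_r²/φ_ω(r)` plus the `y`-difference terms (which need Lemma 8.4 / Lemma 8.3).

## References
* J. Maynard, *Dense clusters of primes in subsets*, Compositio Math. 152 (2016), §7, Prop. 9.1
  [Maynard2016DenseClusters].
* K. Ford, B. Green, S. Konyagin, J. Maynard, T. Tao, *Long gaps between primes*, JAMS 31 (2018),
  (7.5)–(7.7) [FordGreenKonyaginMaynardTao2018].
-/

noncomputable section

open Finset
open scoped ArithmeticFunction.Moebius

namespace Literature.NumberTheory.Sieve.FGKMT2018

variable {k : ℕ}

/-! ### Admissible indices -/

open scoped Classical in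
/-- The admissible indices of `𝒟_k(𝓛)` at the prime `p`: `j` such that `j` is the least index
with `p ∣ L_j(n)` for some root `n (mod p)` of `∏ L_i` (Maynard's `j_{p,1}, …, j_{p,ω(p)}`).
[cite: Maynard2016DenseClusters, §7 p. 13] -/
def admIdx (L : Fin k → ℤ × ℤ) (p : ℕ) : Finset (Fin k) :=
  Finset.univ.filter fun j => ∃ n ∈ Finset.range p,
    (p : ℤ) ∣ formEval (L j) n ∧ ∀ j' : Fin k, j' < j → ¬ (p : ℤ) ∣ formEval (L j') n

/-- Membership in `admIdx`. [cite: Maynard2016DenseClusters, §7 p. 13] -/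
theorem mem_admIdx {L : Fin k → ℤ × ℤ} {p : ℕ} {j : Fin k} :
    j ∈ admIdx L p ↔ ∃ n ∈ Finset.range p,
      (p : ℤ) ∣ formEval (L j) n ∧ ∀ j' : Fin k, j' < j → ¬ (p : ℤ) ∣ formEval (L j') n := by
  unfold admIdx
  rw [Finset.mem_filter]
  simp only [Finset.mem_univ, true_and]

/-- For an admissible family (`(a_j, b_j) = 1`): if `p ∣ L_j(n)` for some `n` then `p ∤ a_j`.
[cite: Maynard2016DenseClusters, §7 p. 13 («none of the `L_i` are a multiple of `p`»)] -/
theorem not_intDvd_fst_of_dvd_formEval {L : Fin k → ℤ × ℤ} (hadm : FormsAdmissible L) (j : Fin k)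
    {p : ℕ} (hp : p.Prime) {n : ℤ} (hn : (p : ℤ) ∣ formEval (L j) n) : ¬ (p : ℤ) ∣ (L j).1 := by
  intro hpa
  have hpb : (p : ℤ) ∣ (L j).2 := by
    have : (L j).2 = formEval (L j) n - (L j).1 * n := by unfold formEval; ring
    rw [this]; exact dvd_sub hn (hpa.mul_right _)
  have hg : p ∣ Int.gcd (L j).1 (L j).2 := Int.dvd_gcd hpa hpb
  rw [intGcd_eq_one_of_formsAdmissible hadm j] at hg
  exact hp.ne_one (Nat.dvd_one.1 hg)

/-- **`#admIdx L p = ω_𝓛(p)`** for admissible `𝓛`: the roots of `∏ L_i (mod p)` correspond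
bijectively to their least indices («the indices `j_{p,1}, …, j_{p,ω(p)}` we have chosen must be
distinct»). [cite: Maynard2016DenseClusters, §7 p. 13] -/
theorem card_admIdx {L : Fin k → ℤ × ℤ} (hadm : FormsAdmissible L) {p : ℕ} (hp : p.Prime) :
    #(admIdx L p) = omegaL L p := by
  classical
  have hpZ : Prime (p : ℤ) := Nat.prime_iff_prime_int.1 hp
  unfold omegaL
  symm
  -- `J n` = indices `j` with `p ∣ L_j(n)`
  have hJ : ∀ n ∈ (Finset.range p).filter (fun n : ℕ => (p : ℤ) ∣ ∏ i, formEval (L i) n),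
      (Finset.univ.filter fun j : Fin k => (p : ℤ) ∣ formEval (L j) n).Nonempty := by
    intro n hn
    obtain ⟨-, hdvd⟩ := Finset.mem_filter.1 hn
    obtain ⟨i, -, hi⟩ := (hpZ.dvd_finsetProd_iff _).1 hdvd
    exact ⟨i, Finset.mem_filter.2 ⟨Finset.mem_univ i, hi⟩⟩
  refine Finset.card_bij
    (fun n hn => (Finset.univ.filter fun j : Fin k => (p : ℤ) ∣ formEval (L j) n).min' (hJ n hn))
    ?_ ?_ ?_
  · -- lands in `admIdx`
    intro n hn
    have hmem := Finset.min'_mem _ (hJ n hn)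
    obtain ⟨hnr, -⟩ := Finset.mem_filter.1 hn
    refine mem_admIdx.2 ⟨n, hnr, (Finset.mem_filter.1 hmem).2, fun j' hj' hdvd => ?_⟩
    have hle := Finset.min'_le (Finset.univ.filter fun j : Fin k => (p : ℤ) ∣ formEval (L j) n) j'
      (Finset.mem_filter.2 ⟨Finset.mem_univ j', hdvd⟩)
    exact absurd hj' (not_lt.2 hle)
  · -- injective: one root per form
    intro n₁ hn₁ n₂ hn₂ heq
    have h1 := Finset.min'_mem _ (hJ n₁ hn₁)
    have h2 := Finset.min'_mem _ (hJ n₂ hn₂)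
    rw [← heq] at h2
    have hd1 := (Finset.mem_filter.1 h1).2
    have hd2 := (Finset.mem_filter.1 h2).2
    have hsub := root_unique _ hp (not_intDvd_fst_of_dvd_formEval hadm _ hp hd1) hd1 hd2
    have hlt1 := Finset.mem_range.1 (Finset.mem_filter.1 hn₁).1
    have hlt2 := Finset.mem_range.1 (Finset.mem_filter.1 hn₂).1
    have h0 : ((n₁ : ℤ) - n₂) = 0 :=
      Int.eq_zero_of_abs_lt_dvd hsub (abs_sub_lt_iff.2 ⟨by omega, by omega⟩)
    omega
  · -- surjective
    intro j hj
    obtain ⟨n, hn, hdvd, hmin⟩ := mem_admIdx.1 hj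
    have hnR : n ∈ (Finset.range p).filter (fun n : ℕ => (p : ℤ) ∣ ∏ i, formEval (L i) n) :=
      Finset.mem_filter.2 ⟨hn, hdvd.trans (Finset.dvd_prod_of_mem _ (Finset.mem_univ j))⟩
    refine ⟨n, hnR, le_antisymm (Finset.min'_le
      (Finset.univ.filter fun j : Fin k => (p : ℤ) ∣ formEval (L j) n) j
      (Finset.mem_filter.2 ⟨Finset.mem_univ j, hdvd⟩)) ?_⟩
    by_contra hlt
    have hmem := Finset.min'_mem _ (hJ n hnR)
    exact hmin _ (not_le.1 hlt) (Finset.mem_filter.1 hmem).2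

/-! ### Putting a prime at an admissible coordinate -/

/-- Membership in `𝒟_k(𝓛)` unfolded. [cite: FordGreenKonyaginMaynardTao2018, (7.5) p. 21] -/
theorem mem_dkBox_iff {L : Fin k → ℤ × ℤ} {B : ℕ} {R : ℝ} {d : Fin k → ℕ} :
    d ∈ dkBox L B R ↔ (∀ i, d i ∈ Finset.Icc 1 ⌊R⌋₊) ∧ Squarefree (∏ i, d i) ∧
      (∏ i, d i).Coprime (wCut k B * B) ∧
      ∀ j : Fin k, ∀ p ∈ (d j).primeFactors, ∃ n ∈ Finset.range p, (p : ℤ) ∣ formEval (L j) n ∧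
        ∀ j' : Fin k, j' < j → ¬ (p : ℤ) ∣ formEval (L j') n := by
  classical
  unfold dkBox
  rw [Finset.mem_filter, Fintype.mem_piFinset]

/-- For `s ∈ 𝒟_k(𝓛)`, a prime `p ∤ ∏sᵢ` coprime to `WB`, and an admissible index `j` for `p`
(with `s_j p ≤ ⌊R⌋`): `s·p@j ∈ 𝒟_k(𝓛)`. [cite: Maynard2016DenseClusters, §7 p. 13 and proof of Prop. 9.1 p. 19 («choices of `s`»)] -/
theorem update_mul_mem_dkBox {L : Fin k → ℤ × ℤ} {B : ℕ} {R : ℝ} {s : Fin k → ℕ}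
    (hs : s ∈ dkBox L B R) {p : ℕ} (hp : p.Prime) {j : Fin k} (hj : j ∈ admIdx L p)
    (hps : ¬ p ∣ ∏ i, s i) (hpW : p.Coprime (wCut k B * B)) (hb : s j * p ≤ ⌊R⌋₊) :
    Function.update s j (s j * p) ∈ dkBox L B R := by
  classical
  rw [mem_dkBox_iff] at hs ⊢
  obtain ⟨hbox, hsq, hcop, hadmS⟩ := hs
  have hs1 : ∀ i, 1 ≤ s i := fun i => (Finset.mem_Icc.1 (hbox i)).1
  refine ⟨fun i => ?_, ?_, ?_, fun i q hq => ?_⟩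
  · by_cases hi : i = j
    · subst hi
      rw [Function.update_self]
      exact Finset.mem_Icc.2 ⟨Nat.one_le_iff_ne_zero.2
        (Nat.mul_ne_zero (Nat.one_le_iff_ne_zero.1 (hs1 i)) hp.ne_zero), hb⟩
    · rw [Function.update_of_ne hi]; exact hbox i
  · rw [prod_update_mul]
    exact Nat.squarefree_mul_iff.2
      ⟨(Nat.Prime.coprime_iff_not_dvd hp).2 hps, (Nat.prime_iff.1 hp).squarefree, hsq⟩
  · rw [prod_update_mul]; exact Nat.coprime_mul_iff_left.2 ⟨hpW, hcop⟩
  · by_cases hi : i = j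
    · subst hi
      rw [Function.update_self, Nat.primeFactors_mul (Nat.one_le_iff_ne_zero.1 (hs1 i)) hp.ne_zero,
        Finset.mem_union, hp.primeFactors, Finset.mem_singleton] at hq
      rcases hq with hq | rfl
      · exact hadmS i q hq
      · exact mem_admIdx.1 hj
    · rw [Function.update_of_ne hi] at hq; exact hadmS i q hq

/-- `φ_ω(N) = (p − ω(p)) φ_ω(N/p)` for squarefree `N` and a prime `p ∣ N`.
[cite: FordGreenKonyaginMaynardTao2018, §7 p. 21 (φ_ω multiplicative)] -/
theorem phiOmega_eq_mul_div (L : Fin k → ℤ × ℤ) {N p : ℕ} (hN : Squarefree N) (hp : p.Prime)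
    (hpN : p ∣ N) : phiOmega L N = ((p : ℝ) - omegaL L p) * phiOmega L (N / p) := by
  classical
  unfold phiOmega
  rw [primeFactors_div_of_squarefree hN hp hpN,
    Finset.mul_prod_erase N.primeFactors (fun q => ((q : ℝ) - omegaL L q))
      (Nat.mem_primeFactors.2 ⟨hp, hpN, hN.ne_zero⟩)]

/-! ### `∑_s T(r,s) = φ_ω(r)` -/

/-- **`∑_{s ∈ 𝒟_k(𝓛), ∏s = N} T(r,s) = φ_ω(N)`** for `r ∈ 𝒟_k(𝓛)` with `∏rᵢ = N ≤ ⌊R⌋`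
(induction on `N`, peeling one prime with (9.5)). [cite: Maynard2016DenseClusters, proof of Prop. 9.1 pp. 19–20 («ω(p) − 1 choices of s», main term `= ∑_r y_r²/φ_ω(r)`)] -/
theorem sum_filter_localPairSum_eq_phiOmega {L : Fin k → ℤ × ℤ} (hadm : FormsAdmissible L)
    (B : ℕ) (R : ℝ) :
    ∀ (N : ℕ) (r : Fin k → ℕ), r ∈ dkBox L B R → (∏ i, r i) = N → N ≤ ⌊R⌋₊ →
      ∑ s ∈ (dkBox L B R).filter (fun s => (∏ i, s i) = N), localPairSum L B R r s =
        phiOmega L N := by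
  classical
  intro N
  induction N using Nat.strong_induction_on with
  | _ N ih =>
    intro r hr hrN hNR
    by_cases hN1 : N = 1
    · subst hN1
      have hr1 : r = fun _ => 1 := funext fun i => Nat.dvd_one.1 (by
        rw [← hrN]; exact Finset.dvd_prod_of_mem r (Finset.mem_univ i))
      subst hr1
      have hset : (dkBox L B R).filter (fun s => (∏ i, s i) = 1) = {fun _ => 1} := by
        ext s
        simp only [Finset.mem_filter, Finset.mem_singleton]
        constructor
        · rintro ⟨-, hs1⟩
          exact funext fun i => Nat.dvd_one.1 (by
            rw [← hs1]; exact Finset.dvd_prod_of_mem s (Finset.mem_univ i))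
        · rintro rfl; exact ⟨hr, by simp⟩
      rw [hset, Finset.sum_singleton, localPairSum_one_one hr]
      unfold phiOmega
      rw [Nat.primeFactors_one, Finset.prod_empty]
    · -- inductive step: peel the least prime of `N`
      have hN0 : 0 < N := by
        rw [← hrN]; exact Finset.prod_pos fun i _ => one_le_of_mem_dkBox hr i
      have hp : N.minFac.Prime := Nat.minFac_prime hN1
      have hpN : N.minFac ∣ N := Nat.minFac_dvd N
      have hsqN : Squarefree N := by rw [← hrN]; exact squarefree_of_mem_dkBox hr
      have hcopN : N.Coprime (wCut k B * B) := by rw [← hrN]; exact (mem_dkBox_iff.1 hr).2.2.1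
      have hpW : N.minFac.Coprime (wCut k B * B) := Nat.Coprime.coprime_dvd_left hpN hcopN
      have hndiv : ¬ N.minFac ∣ N / N.minFac := by
        rw [Nat.dvd_div_iff_mul_dvd hpN]
        exact fun h => hp.not_isUnit (hsqN _ h)
      have hpr : N.minFac ∣ ∏ i, r i := by rw [hrN]; exact hpN
      obtain ⟨j, -, hpj⟩ := ((Nat.prime_iff.1 hp).dvd_finsetProd_iff _).1 hpr
      have hjmem : j ∈ admIdx L N.minFac :=
        mem_admIdx.2 (exists_root_of_mem_dkBox hr j
          (Nat.mem_primeFactors.2 ⟨hp, hpj, Nat.one_le_iff_ne_zero.1 (one_le_of_mem_dkBox hr j)⟩))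
      -- the peeled vector `r' = r/p@j`
      have hr' := update_div_mem_dkBox hr j hpj
      have hr'N : (∏ i, Function.update r j (r j / N.minFac) i) = N / N.minFac :=
        (Nat.div_eq_of_eq_mul_right hp.pos (by rw [mul_prod_update_div r j hpj, hrN])).symm
      have IH := ih (N / N.minFac) (Nat.div_lt_self hN0 hp.one_lt) _ hr' hr'N
        ((Nat.div_le_self _ _).trans hNR)
      -- (1) each `s` with `∏s = N` has exactly one coordinate divisible by `p`
      have hone : ∀ s ∈ (dkBox L B R).filter (fun s => (∏ i, s i) = N),
          ∑ j' ∈ (Finset.univ : Finset (Fin k)),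
            (if N.minFac ∣ s j' then localPairSum L B R r s else 0) = localPairSum L B R r s := by
        intro s hs
        obtain ⟨hsbox, hsN⟩ := Finset.mem_filter.1 hs
        have hps : N.minFac ∣ ∏ i, s i := by rw [hsN]; exact hpN
        obtain ⟨j₀, -, hj₀⟩ := ((Nat.prime_iff.1 hp).dvd_finsetProd_iff _).1 hps
        rw [← Finset.sum_filter]
        have hset : Finset.univ.filter (fun j' => N.minFac ∣ s j') = {j₀} := by
          ext i
          simp only [Finset.mem_filter, Finset.mem_univ, true_and, Finset.mem_singleton]
          constructor
          · intro hpi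
            by_contra hne
            have hg := Nat.dvd_gcd hpi hj₀
            rw [(coprime_apply_of_mem_dkBox hsbox hne).gcd_eq_one] at hg
            exact hp.one_lt.ne' (Nat.dvd_one.1 hg)
          · rintro rfl; exact hj₀
        rw [hset, Finset.sum_singleton]
      -- (2) for `j' ∉ admIdx` no such `s` has `p ∣ s_{j'}`
      have hzero : ∀ j' ∈ (Finset.univ : Finset (Fin k)), j' ∉ admIdx L N.minFac →
          ∑ s ∈ ((dkBox L B R).filter (fun s => (∏ i, s i) = N)).filter
            (fun s => N.minFac ∣ s j'), localPairSum L B R r s = 0 := by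
        intro j' _ hj'
        refine Finset.sum_eq_zero fun s hs => ?_
        obtain ⟨hs1, hpj'⟩ := Finset.mem_filter.1 hs
        obtain ⟨hsbox, -⟩ := Finset.mem_filter.1 hs1
        exact (hj' (mem_admIdx.2 (exists_root_of_mem_dkBox hsbox j'
          (Nat.mem_primeFactors.2 ⟨hp, hpj',
            Nat.one_le_iff_ne_zero.1 (one_le_of_mem_dkBox hsbox j')⟩)))).elim
      -- (3) for `j' ∈ admIdx`: `s ↦ s/p@j'` is a bijection onto `∏s' = N/p`, and (9.5) peels
      have hstep : ∀ j' ∈ admIdx L N.minFac,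
          ∑ s ∈ ((dkBox L B R).filter (fun s => (∏ i, s i) = N)).filter
            (fun s => N.minFac ∣ s j'), localPairSum L B R r s =
          ∑ s' ∈ (dkBox L B R).filter (fun s => (∏ i, s i) = N / N.minFac),
            (if j = j' then (N.minFac : ℝ) - 1 else -1) *
              localPairSum L B R (Function.update r j (r j / N.minFac)) s' := by
        intro j' hj'
        symm
        refine Finset.sum_bij' (fun s' _ => Function.update s' j' (s' j' * N.minFac))
          (fun s _ => Function.update s j' (s j' / N.minFac)) ?_ ?_ ?_ ?_ ?_
        · -- `s'·p@j'` lies in the target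
          intro s' hs'
          obtain ⟨hs'box, hs'N⟩ := Finset.mem_filter.1 hs'
          have hprod : (∏ i, Function.update s' j' (s' j' * N.minFac) i) = N := by
            rw [prod_update_mul, hs'N, Nat.mul_div_cancel' hpN]
          have hb : s' j' * N.minFac ≤ ⌊R⌋₊ := by
            refine le_trans (Nat.le_of_dvd hN0 ?_) hNR
            have h := Finset.dvd_prod_of_mem (Function.update s' j' (s' j' * N.minFac))
              (Finset.mem_univ j')
            rwa [Function.update_self, hprod] at h
          have hps' : ¬ N.minFac ∣ ∏ i, s' i := by rw [hs'N]; exact hndiv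
          refine Finset.mem_filter.2 ⟨Finset.mem_filter.2
            ⟨update_mul_mem_dkBox hs'box hp hj' hps' hpW hb, hprod⟩, ?_⟩
          rw [Function.update_self]; exact dvd_mul_left _ _
        · -- `s/p@j'` lies in the source
          intro s hs
          obtain ⟨hs1, hpsj⟩ := Finset.mem_filter.1 hs
          obtain ⟨hsbox, hsN⟩ := Finset.mem_filter.1 hs1
          refine Finset.mem_filter.2 ⟨update_div_mem_dkBox hsbox j' hpsj, ?_⟩
          exact (Nat.div_eq_of_eq_mul_right hp.pos
            (by rw [mul_prod_update_div s j' hpsj, hsN])).symm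
        · intro s' hs'
          rw [Function.update_idem, Function.update_self, Nat.mul_div_cancel _ hp.pos,
            Function.update_eq_self]
        · intro s hs
          obtain ⟨-, hpsj⟩ := Finset.mem_filter.1 hs
          rw [Function.update_idem, Function.update_self, Nat.div_mul_cancel hpsj,
            Function.update_eq_self]
        · -- the summands agree: (9.5) peeling
          intro s' hs'
          obtain ⟨hs'box, hs'N⟩ := Finset.mem_filter.1 hs'
          have hprod : (∏ i, Function.update s' j' (s' j' * N.minFac) i) = N := by
            rw [prod_update_mul, hs'N, Nat.mul_div_cancel' hpN]
          have hb : s' j' * N.minFac ≤ ⌊R⌋₊ := by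
            refine le_trans (Nat.le_of_dvd hN0 ?_) hNR
            have h := Finset.dvd_prod_of_mem (Function.update s' j' (s' j' * N.minFac))
              (Finset.mem_univ j')
            rwa [Function.update_self, hprod] at h
          have hps' : ¬ N.minFac ∣ ∏ i, s' i := by rw [hs'N]; exact hndiv
          have hsbox := update_mul_mem_dkBox hs'box hp hj' hps' hpW hb
          have hpj' : N.minFac ∣ Function.update s' j' (s' j' * N.minFac) j' := by
            rw [Function.update_self]; exact dvd_mul_left _ _
          rw [localPairSum_peel hr hsbox hp hpj hpj', Function.update_self, Function.update_idem,
            Nat.mul_div_cancel _ hp.pos, Function.update_eq_self]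
      -- (4) the sum of the local factors over the admissible indices
      have hsumc : ∑ j' ∈ admIdx L N.minFac, (if j = j' then (N.minFac : ℝ) - 1 else -1) =
          (N.minFac : ℝ) - #(admIdx L N.minFac) := by
        have hsplit : ∀ j' : Fin k, (if j = j' then (N.minFac : ℝ) - 1 else -1) =
            (if j = j' then (N.minFac : ℝ) else 0) - 1 := by
          intro j'; split_ifs <;> ring
        simp_rw [hsplit]
        rw [Finset.sum_sub_distrib, Finset.sum_ite_eq, if_pos hjmem, Finset.sum_const, nsmul_eq_mul,
          mul_one]
      -- assemble
      calc ∑ s ∈ (dkBox L B R).filter (fun s => (∏ i, s i) = N), localPairSum L B R r s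
          = ∑ s ∈ (dkBox L B R).filter (fun s => (∏ i, s i) = N),
              ∑ j' ∈ (Finset.univ : Finset (Fin k)),
                (if N.minFac ∣ s j' then localPairSum L B R r s else 0) :=
            Finset.sum_congr rfl fun s hs => (hone s hs).symm
        _ = ∑ j' ∈ (Finset.univ : Finset (Fin k)),
              ∑ s ∈ (dkBox L B R).filter (fun s => (∏ i, s i) = N),
                (if N.minFac ∣ s j' then localPairSum L B R r s else 0) := Finset.sum_comm
        _ = ∑ j' ∈ (Finset.univ : Finset (Fin k)),
              ∑ s ∈ ((dkBox L B R).filter (fun s => (∏ i, s i) = N)).filter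
                (fun s => N.minFac ∣ s j'), localPairSum L B R r s :=
            Finset.sum_congr rfl fun j' _ => (Finset.sum_filter _ _).symm
        _ = ∑ j' ∈ admIdx L N.minFac,
              ∑ s ∈ ((dkBox L B R).filter (fun s => (∏ i, s i) = N)).filter
                (fun s => N.minFac ∣ s j'), localPairSum L B R r s :=
            (Finset.sum_subset (Finset.subset_univ _) hzero).symm
        _ = ∑ j' ∈ admIdx L N.minFac,
              ∑ s' ∈ (dkBox L B R).filter (fun s => (∏ i, s i) = N / N.minFac),
                (if j = j' then (N.minFac : ℝ) - 1 else -1) *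
                  localPairSum L B R (Function.update r j (r j / N.minFac)) s' :=
            Finset.sum_congr rfl hstep
        _ = ∑ j' ∈ admIdx L N.minFac,
              (if j = j' then (N.minFac : ℝ) - 1 else -1) * phiOmega L (N / N.minFac) := by
            refine Finset.sum_congr rfl fun j' _ => ?_
            rw [← Finset.mul_sum, IH]
        _ = ((N.minFac : ℝ) - #(admIdx L N.minFac)) * phiOmega L (N / N.minFac) := by
            rw [← Finset.sum_mul, hsumc]
        _ = phiOmega L N := by
            rw [card_admIdx hadm hp, ← phiOmega_eq_mul_div L hsqN hp hpN]

/-- **`∑_{s ∈ 𝒟_k(𝓛)} T(r,s) = φ_ω(r)`** for `r ∈ 𝒟_k(𝓛)` with `∏rᵢ ≤ ⌊R⌋` (the vectors `s`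
with `∏s ≠ ∏r` contribute `0` by `localPairSum_eq_zero_of_prod_ne`). This is the exact form of
Maynard's «`ω(p) − 1` choices of `s`» count combined with (9.5).
[cite: Maynard2016DenseClusters, proof of Prop. 9.1 pp. 19–20] -/
theorem sum_localPairSum_eq_phiOmega {L : Fin k → ℤ × ℤ} (hadm : FormsAdmissible L) {B : ℕ} {R : ℝ}
    {r : Fin k → ℕ} (hr : r ∈ dkBox L B R) (hrR : (∏ i, r i) ≤ ⌊R⌋₊) :
    ∑ s ∈ dkBox L B R, localPairSum L B R r s = phiOmega L (∏ i, r i) := by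
  classical
  have h : ∀ s ∈ dkBox L B R, localPairSum L B R r s ≠ 0 → (∏ i, s i) = ∏ i, r i := by
    intro s hs hne
    by_contra hc
    exact hne (localPairSum_eq_zero_of_prod_ne hr hs (fun h => hc h.symm))
  rw [← Finset.sum_filter_of_ne h]
  exact sum_filter_localPairSum_eq_phiOmega hadm B R _ r hr rfl hrR

end Literature.NumberTheory.Sieve.FGKMT2018
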